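import Literature.AlgebraicGeometry.RelativeSpec.SubringSpecAut
import Literature.AlgebraicGeometry.RelativeSpec.GermSubfieldSpec
import Literature.AlgebraicGeometry.RelativeSpec.FiniteGroupQuotientFinsetAffine
import Literature.AlgebraicGeometry.Resolution.FiniteBirationalNormal
import Mathlib.AlgebraicGeometry.Morphisms.Finite
import Mathlib.AlgebraicGeometry.Morphisms.Proper
import Mathlib.Algebra.CharP.Reduced
import HarnessLib

/-!
# Normal sandwich models of stable subfields (infinitesimal quotients of Galois alterations)

Let `π : X₁ → X` be a proper dominant morphism of integral schemes, invariant under an action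
`ρ` of a group `G` on `X₁`, and let `M ⊆ L = K(X₁)` be a `G`-stable subfield of the form
`M = K·L^{pⁿ}`, `K = π^* K(X)`. Given an integral, locally of finite type, `G`-invariant
`f' : X₁ → Y` over `X` whose sections have generic germs in `M` (constructed in
`Literature.AlgebraicGeometry.Resolution.GaloisAlterationSandwichBase`), the relative spectrum
`Z = Spec_Y(f'_*𝒪_{X₁} ∩ M)` (`RelativeSpec.germDatum`) is the **normal sandwich model of `M`**:

  `X₁ —u→ Z —v→ X`, `u ≫ v = π`, `u` finite surjective `G`-equivariant, `v` proper `G`-invariant,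
  `u^* K(Z) = M`, `Z` normal, and `G` acts faithfully on `Z` if it does on `X₁`

(`exists_sandwichModel`). This is de Jong's level-`n` infinitesimal quotient of a Galois
alteration (de Jong 1997, 5.3 and Thm. 5.13): `𝒪_Z = 𝒪_{X₁} ∩ Mₙ`.

* `SubringDatum.isIntegralHom_toSpec`, `isFinite_toSpec`, `surjective_toSpec`,
  `app_toSpec_injective` — for an integral `f`, `X → Spec_Y(D.ring)` is integral (finite if `f`
  is locally of finite type) and surjective, with injective pull-back on sections;
* `exists_toAut_germDatum` — the `G`-action on `Z` (through `RelativeSpec.SubringDatum.toAut`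
  applied to `(g⁻¹)^*` on the stable rings `Γ(X₁, f'⁻¹U) ∩ M`), equivariance of `u`, and
  `Z → Y` invariant;
* `range_functionFieldMap_toSpec_germDatum` — `u^* K(Z) = M`;
* `exists_sandwichModel` — the assembly, including compactness, properness of `v`
  (Artin–Tate), generic finiteness of `v` (Zariski's Main Theorem), finite subsets of `Z` in
  affine opens, and faithfulness (an automorphism over `X` acting trivially on `Z` fixes
  `M ⊇ L^{pⁿ}`, hence `L`, hence is the identity).

## References

* A. J. de Jong, *Families of curves and alterations*, Ann. Inst. Fourier 47 (1997), 5.3,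
  Thm. 5.13. [DeJong1997]
* [StacksProject, Tag 01LQ], [Tag 02UP]. [MumfordAV1970] §7.
-/

noncomputable section

universe u

open CategoryTheory Limits AlgebraicGeometry
open Literature.AlgebraicGeometry.RelativeSpec
open Literature.AlgebraicGeometry.Motives Literature.AlgebraicGeometry.Motives.RatFn

/-! ### `X → Spec_Y(D.ring)` for an integral structure map -/

namespace Literature.AlgebraicGeometry.RelativeSpec.SubringDatum

variable {X Y : Scheme.{u}} {f : X ⟶ Y} (D : SubringDatum f) [IsIntegralHom f]

/-- `toSpec : X → Spec_Y(D.ring)` is integral when `f` is (`toSpec ≫ fromSpec = f` with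
`fromSpec` affine, hence separated). [folklore] -/
theorem isIntegralHom_toSpec : IsIntegralHom D.toSpec := by
  have : IsIntegralHom (D.toSpec ≫ D.fromSpec) := by rw [D.toSpec_fromSpec]; infer_instance
  exact IsIntegralHom.of_comp D.toSpec D.fromSpec

/-- `toSpec : X → Spec_Y(D.ring)` is finite when `f` is integral and locally of finite type.
[folklore] -/
theorem isFinite_toSpec [LocallyOfFiniteType f] : IsFinite D.toSpec := by
  haveI := D.isIntegralHom_toSpec
  have : LocallyOfFiniteType (D.toSpec ≫ D.fromSpec) := by rw [D.toSpec_fromSpec]; infer_instance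
  haveI := locallyOfFiniteType_of_comp D.toSpec D.fromSpec
  exact (IsFinite.iff_isIntegralHom_and_locallyOfFiniteType _).mpr ⟨inferInstance, inferInstance⟩

/-- `toSpec : X → Spec_Y(D.ring)` is surjective when `f` is integral (closed and dominant).
[folklore] -/
theorem surjective_toSpec : Function.Surjective D.toSpec := by
  haveI := D.isIntegralHom_toSpec
  exact surjective_of_universallyClosed_of_isDominant D.toSpec

omit [IsIntegralHom f] in
/-- `toSpec^*` is injective on the sections over every affine open of `Spec_Y(D.ring)`
(`ker toSpec = ⊥`). [folklore] -/
theorem app_toSpec_injective [QuasiCompact f] [QuasiSeparated f] (U : D.spec.affineOpens) :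
    Function.Injective (D.toSpec.app U.1) := by
  have h := congrArg (fun I : D.spec.IdealSheafData ↦ I.ideal U) D.ker_toSpec
  simp only [Scheme.Hom.ker_apply, Scheme.IdealSheafData.ideal_bot, Pi.bot_apply] at h
  rw [RingHom.injective_iff_ker_eq_bot]
  exact h

end Literature.AlgebraicGeometry.RelativeSpec.SubringDatum

namespace Literature.AlgebraicGeometry.Resolution

variable {X₁ Y : Scheme.{u}} [IsIntegral X₁] {f' : X₁ ⟶ Y} [IsIntegralHom f']
  (M : Subfield X₁.functionField)
  (happ : ∀ (U : Y.Opens) (a : Γ(Y, U)) (h : genericPoint X₁ ∈ f' ⁻¹ᵁ U),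
    X₁.presheaf.germ (f' ⁻¹ᵁ U) (genericPoint X₁) h (f'.app U a) ∈ M)

/-! ### The action of `G` on `Spec_Y(f'_*𝒪 ∩ M)` -/

set_option backward.isDefEq.respectTransparency false in
/-- **The group action on the sandwich model.** If `G` acts on `X₁` over `Y` (`f'` invariant)
and `M` is `G`-stable, then `G` acts on `Z = Spec_Y(f'_*𝒪_{X₁} ∩ M)` over `Y`, and
`u : X₁ → Z` is equivariant: the rings `Γ(X₁, f'⁻¹U) ∩ M` are stable under the `(g⁻¹)^*`
(generic germs transform through `(g⁻¹)^*` on `K(X₁)`), and `RelativeSpec.SubringDatum.toAut`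
applies. [cite: DeJong1997, 5.3 (the action on the infinitesimal quotients)] -/
theorem exists_toAut_germDatum {G : Type*} [Group G] (ρ : G →* Aut X₁)
    (hinv : ∀ g : G, (ρ g).hom ≫ f' = f')
    (hstab : ∀ (g : G) (a : X₁.functionField), a ∈ M → functionFieldMap (ρ g).hom a ∈ M) :
    ∃ ρZ : G →* Aut (germDatum f' M happ).spec,
      (∀ g : G, (ρ g).hom ≫ (germDatum f' M happ).toSpec =
        (germDatum f' M happ).toSpec ≫ (ρZ g).hom) ∧
      (∀ g : G, (ρZ g).hom ≫ (germDatum f' M happ).fromSpec = (germDatum f' M happ).fromSpec) := by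
  set D := germDatum f' M happ
  let ρB : ActionOver f' G := ⟨ρ, hinv⟩
  have hst : ∀ (g : G) (U : Y.Opens) (s : Γ(X₁, f' ⁻¹ᵁ U)), s ∈ D.ring U →
      ρB.act g U s ∈ D.ring U := by
    intro g U s hs h
    change ∀ h, _ ∈ M at hs
    rw [ActionOver.act_apply, germ_appLE_eq_functionFieldMap (ρB.aut g⁻¹).hom _ h h s]
    exact hstab g⁻¹ _ (hs h)
  let σ : G → D.Endo := fun g ↦
    { toFun := fun U ↦ (ρB.act g U.1).restrict (D.ring U.1) (D.ring U.1) (hst g U.1)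
      map_apply := fun i x ↦ Subtype.ext (ρB.map_act i g x.1)
      apply_app := fun U a ↦ Subtype.ext (ρB.act_app g U.1 a) }
  have σ_one : σ 1 = SubringDatum.Endo.id := SubringDatum.Endo.ext fun U ↦ RingHom.ext fun x ↦
    Subtype.ext (by change ρB.act 1 U.1 x.1 = x.1; rw [ρB.act_one]; rfl)
  have σ_mul : ∀ g h : G, σ (g * h) = (σ g).comp (σ h) := fun g h ↦
    SubringDatum.Endo.ext fun U ↦ RingHom.ext fun x ↦ Subtype.ext (by
      change ρB.act (g * h) U.1 x.1 = ρB.act g U.1 (ρB.act h U.1 x.1); rw [ρB.act_mul]; rfl)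
  refine ⟨D.toAut σ σ_one σ_mul, fun g ↦ ?_, fun g ↦ D.toAut_hom_fromSpec σ σ_one σ_mul g⟩
  rw [D.toAut_hom]
  have h := D.comp_toSpec_eq_toSpec_specMap (ρB.aut g⁻¹⁻¹).hom (ρB.aut_comp g⁻¹⁻¹) (σ g⁻¹)
    fun U s ↦ rfl
  simpa only [inv_inv] using h

/-! ### The function field of the sandwich model -/

/-- A morphism through which a dominant morphism factors (after a surjection... here: after any
morphism) is dominant. [folklore] -/
theorem isDominant_of_comp_eq {A B C : Scheme.{u}} (a : A ⟶ B) (b : B ⟶ C) (w : A ⟶ C)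
    [IsDominant w] (h : a ≫ b = w) : IsDominant b :=
  ⟨w.denseRange.mono (by
    rw [← h, Scheme.Hom.comp_base, TopCat.coe_comp]
    exact Set.range_comp_subset_range _ _)⟩

/-- **`u^* K(Z) = M`** for the sandwich model `Z = Spec_Y(f'_*𝒪 ∩ M)` of
`M = closure (π^* K(X) ∪ L^q)`, `π = f' ≫ v₀`: `⊆` by construction, and `⊇` because `π^*`
factors through `u^*` while `a^q = s^q / t^q` for sections `s, t` of a chart, with `s^q, t^q`
in `Γ ∩ M`. [cite: DeJong1997, 5.3] -/
theorem range_functionFieldMap_toSpec_germDatum {X : Scheme.{u}} [IsIntegral X] (π : X₁ ⟶ X)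
    [IsDominant π] (v₀ : Y ⟶ X) (hfac : f' ≫ v₀ = π) (q : ℕ)
    (hM : M = Subfield.closure (Set.range (functionFieldMap π) ∪
      Set.range fun a : X₁.functionField => a ^ q)) :
    Set.range (functionFieldMap (germDatum f' M happ).toSpec) = (M : Set X₁.functionField) := by
  set D := germDatum f' M happ
  apply Set.Subset.antisymm
  · rintro _ ⟨b, rfl⟩
    exact functionFieldMap_toSpec_mem happ b
  · change M ≤ (functionFieldMap D.toSpec).fieldRange
    refine hM.le.trans ?_
    rw [Subfield.closure_le]
    rintro a (⟨c, rfl⟩ | ⟨a, rfl⟩)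
    · -- `π^* c = u^* ((fromSpec ≫ v₀)^* c)`
      have hw : D.toSpec ≫ (D.fromSpec ≫ v₀) = π := by rw [D.toSpec_fromSpec_assoc, hfac]
      haveI := isDominant_of_comp_eq _ _ _ hw
      change functionFieldMap π c ∈ Set.range (functionFieldMap D.toSpec)
      have key : ∀ (a b : X₁ ⟶ X) [IsDominant a] [IsDominant b], a = b →
          functionFieldMap a = functionFieldMap b := by
        rintro a b _ _ rfl; rfl
      rw [← key _ _ hw, functionFieldMap_comp]
      exact ⟨_, rfl⟩
    · -- `a ^ q = s^q / t^q` over an affine chart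
      change a ^ q ∈ Set.range (functionFieldMap D.toSpec)
      obtain ⟨_, ⟨U, hU, rfl⟩, hξU, -⟩ := Y.isBasis_affineOpens.exists_subset_of_mem_open
        (Set.mem_univ (f' (genericPoint X₁))) isOpen_univ
      have hξ : genericPoint X₁ ∈ f' ⁻¹ᵁ U := hξU
      haveI : Nonempty (f' ⁻¹ᵁ U : X₁.Opens) := ⟨⟨_, hξ⟩⟩
      haveI := functionField_isFractionRing_of_isAffineOpen X₁ (f' ⁻¹ᵁ U) (hU.preimage f')
      obtain ⟨s, t, -, rfl⟩ := IsFractionRing.div_surjective (A := Γ(X₁, f' ⁻¹ᵁ U)) a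
      have halg : ∀ s : Γ(X₁, f' ⁻¹ᵁ U), algebraMap _ X₁.functionField s =
          X₁.presheaf.germ _ _ hξ s := fun _ ↦ rfl
      rw [halg, halg, div_pow, ← map_pow, ← map_pow]
      have hmem : ∀ s : Γ(X₁, f' ⁻¹ᵁ U), s ^ q ∈ D.ring U := fun s h' ↦ by
        rw [map_pow, hM]
        exact Subfield.subset_closure (Or.inr ⟨_, rfl⟩)
      exact div_mem_range_functionFieldMap_toSpec happ ⟨U, hU⟩ hξ (hmem s) (hmem t)

/-! ### The normal sandwich model -/

include happ in
set_option backward.isDefEq.respectTransparency false in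
/-- **The normal sandwich model of a stable subfield** (de Jong's level-`n` infinitesimal
quotient, de Jong 1997, 5.3 / Thm. 5.13). Let `π : X₁ → X` be proper dominant between integral
schemes, `G`-invariant for a group `G` acting on `X₁` with `g ↦ ρ g` injective on automorphisms
of `X₁`, `X₁` normal and quasi-compact, `X` locally noetherian, `π` finite over a nonempty open;
let `M = closure (π^*K(X) ∪ L^{pⁿ}) ⊆ L = K(X₁)` (`char L = p`) be `G`-stable; and let
`f' : X₁ → Y` be integral, locally of finite type, `G`-invariant, over `X` (`f' ≫ v₀ = π`, `v₀`
separated), with generic germs of `f'^*`-sections in `M` and finite subsets of `Y` in affine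
opens. Then `Z = Spec_Y(f'_*𝒪_{X₁} ∩ M)` with `u = toSpec`, `v = fromSpec ≫ v₀` satisfies:
`u` is `G`-equivariant, finite, surjective; `v` is `G`-invariant, proper, finite over a nonempty
open; `u ≫ v = π`; `u^* K(Z) = M`; `Z` is normal and quasi-compact with finite subsets in affine
opens; and `G → Aut Z` is injective. [cite: DeJong1997, 5.3 and Thm. 5.13] -/
theorem exists_sandwichModel {G : Type u} [Group G] {X : Scheme.{u}} [IsIntegral X]
    (ρ : G →* Aut X₁) (hρ : ∀ g : G, (ρ g).hom = 𝟙 X₁ → g = 1) [LocallyOfFiniteType f']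
    (v₀ : Y ⟶ X) [IsSeparated v₀] (π : X₁ ⟶ X) [IsDominant π] [IsProper π]
    (hfac : f' ≫ v₀ = π) (hinv : ∀ g : G, (ρ g).hom ≫ f' = f')
    (hstab : ∀ (g : G) (a : X₁.functionField), a ∈ M → functionFieldMap (ρ g).hom a ∈ M)
    (p n : ℕ) [ExpChar X₁.functionField p]
    (hM : M = Subfield.closure (Set.range (functionFieldMap π) ∪
      Set.range fun a : X₁.functionField => a ^ p ^ n))
    (hnorm : ∀ x : X₁, IsIntegrallyClosed (X₁.presheaf.stalk x)) [CompactSpace X₁]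
    [IsLocallyNoetherian X]
    (hYaff : ∀ S : Finset Y, ∃ W : Y.Opens, IsAffineOpen W ∧ (↑S : Set Y) ⊆ W)
    (hfin : ∃ U : X.Opens, (U : Set X).Nonempty ∧ IsFinite (π ∣_ U)) :
    ∃ (Z : Scheme.{u}) (_ : IsIntegral Z) (ρZ : G →* Aut Z) (u : X₁ ⟶ Z) (_ : IsDominant u)
      (v : Z ⟶ X), (∀ g : G, (ρ g).hom ≫ u = u ≫ (ρZ g).hom) ∧ (∀ g : G, (ρZ g).hom ≫ v = v) ∧
      u ≫ v = π ∧ IsFinite u ∧ Function.Surjective u.base ∧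
      Set.range (functionFieldMap u) = (M : Set X₁.functionField) ∧
      (∀ z : Z, IsIntegrallyClosed (Z.presheaf.stalk z)) ∧ CompactSpace Z ∧ IsProper v ∧
      (∃ U : X.Opens, (U : Set X).Nonempty ∧ IsFinite (v ∣_ U)) ∧
      (∀ S : Finset Z, ∃ W : Z.Opens, IsAffineOpen W ∧ (↑S : Set Z) ⊆ W) ∧
      Function.Injective ρZ := by
  set D := germDatum f' M happ
  haveI : IsFinite D.toSpec := D.isFinite_toSpec
  have hsurj : Function.Surjective D.toSpec := D.surjective_toSpec
  haveI : Surjective D.toSpec := ⟨hsurj⟩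
  obtain ⟨ρZ, hcomm, hover⟩ := exists_toAut_germDatum M happ ρ hinv hstab
  let v : D.spec ⟶ X := D.fromSpec ≫ v₀
  have fac : D.toSpec ≫ v = π := by
    change D.toSpec ≫ D.fromSpec ≫ v₀ = π
    rw [D.toSpec_fromSpec_assoc, hfac]
  haveI : Surjective (D.toSpec ≫ v) := by
    rw [fac]; exact ⟨surjective_of_universallyClosed_of_isDominant π⟩
  haveI : Surjective v := Surjective.of_comp D.toSpec v
  haveI : IsSeparated v := inferInstanceAs (IsSeparated (D.fromSpec ≫ v₀))
  have hrange := range_functionFieldMap_toSpec_germDatum M happ π v₀ hfac (p ^ n) hM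
  -- normality
  have hnormZ : ∀ z : D.spec, IsIntegrallyClosed (D.spec.presheaf.stalk z) :=
    isIntegrallyClosed_stalk_germDatum happ fun U hne ↦
      @isIntegrallyClosed_sections_of_stalk X₁ _ hnorm ⟨f' ⁻¹ᵁ U.1, U.2.preimage f'⟩ hne
  -- properness of `v`
  haveI : UniversallyClosed (D.toSpec ≫ v) := by rw [fac]; infer_instance
  haveI : UniversallyClosed v := UniversallyClosed.of_comp_surjective D.toSpec v
  haveI : LocallyOfFiniteType (D.toSpec ≫ v) := by rw [fac]; infer_instance
  haveI : LocallyOfFiniteType v :=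
    locallyOfFiniteType_of_isFinite_of_injective D.toSpec v D.app_toSpec_injective
  haveI : IsProper v := {}
  -- generic finiteness of `v`
  have hfinv : ∃ U : X.Opens, (U : Set X).Nonempty ∧ IsFinite (v ∣_ U) := by
    obtain ⟨U₀, ⟨x, hx⟩, hU₀⟩ := hfin
    haveI : IsFinite ((D.toSpec ≫ v) ∣_ U₀) := by rw [fac]; exact hU₀
    obtain ⟨V, hxV, hV⟩ := exists_isFinite_morphismRestrict_of_comp D.toSpec v hsurj U₀ hx
    exact ⟨V, ⟨x, hxV⟩, hV⟩
  -- faithfulness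
  have hinj : Function.Injective ρZ := by
    refine (injective_iff_map_eq_one ρZ).mpr fun g hg ↦ hρ g ?_
    have h1 : (ρ g).hom ≫ D.toSpec = D.toSpec := by
      rw [hcomm g, hg]; exact Category.comp_id _
    have h2 : (functionFieldMap (ρ g).hom).comp (functionFieldMap D.toSpec) =
        functionFieldMap D.toSpec := by
      have key : ∀ (a b : X₁ ⟶ D.spec) [IsDominant a] [IsDominant b], a = b →
          functionFieldMap a = functionFieldMap b := by
        rintro a b _ _ rfl; rfl
      rw [← functionFieldMap_comp D.toSpec (ρ g).hom]
      exact key _ _ h1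
    have h3 : ∀ a : X₁.functionField, a ∈ M → functionFieldMap (ρ g).hom a = a := by
      intro a ha
      have ha' : a ∈ Set.range (functionFieldMap D.toSpec) := by rw [hrange]; exact ha
      obtain ⟨b, rfl⟩ := ha'
      exact RingHom.congr_fun h2 b
    have h4 : functionFieldMap (ρ g).hom = RingHom.id _ := by
      ext a
      apply iterateFrobenius_inj X₁.functionField p n
      rw [iterateFrobenius_def, iterateFrobenius_def, RingHom.id_apply, ← map_pow]
      refine h3 _ ?_
      rw [hM]
      exact Subfield.subset_closure (Or.inr ⟨a, rfl⟩)
    exact eq_id_of_functionFieldMap_eq_id (ρ g).hom π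
      (by rw [← hfac, ← Category.assoc, hinv g]) h4
  refine ⟨D.spec, inferInstance, ρZ, D.toSpec, inferInstance, v, hcomm, fun g ↦ ?_, fac,
    inferInstance, hsurj, hrange, hnormZ, compactSpace_of_surjective D.toSpec hsurj,
    inferInstance, hfinv, exists_isAffineOpen_finset_subset_of_isAffineHom D.fromSpec hYaff, hinj⟩
  change (ρZ g).hom ≫ D.fromSpec ≫ v₀ = D.fromSpec ≫ v₀
  rw [← Category.assoc, hover g]

end Literature.AlgebraicGeometry.Resolution

end
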